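import Summits.PneNP.PneNP.Theses.Mobius
import Summits.QuantumAdvantage.QuantumAdvantage.Theorems.MobiusLadderLiouvilleNotAC0Xor
import Summits.QuantumAdvantage.QuantumAdvantage.Theorems.MobiusLadderLiouvilleNotTC0
import Literature.Computability.Complexity.ACRealizeOver
import Literature.Computability.Complexity.CircuitRestriction
import Literature.Computability.Complexity.StackWords

/-!
# Route Mobius — `DigitalPhasesGlue` (stmt-PneNP-1114)

Rung-2 glue `LiouvilleDigitalPhases → LiouvilleNotAC0Mod2` (`bin {N : λ(N) = 1} ∉ AC⁰[2]`). Three steps: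
(1) the crux, stated for Smolensky's degree filtration `lowDeg (ZMod 2) m ((log₂ m)^c)` on the cube, implies the
QuantumAdvantage MobiusLadder crux `DigitPolyUniformity` (polynomials `P : MvPolynomial (Fin n) (ZMod 2)` of total degree
`≤ (log₂ n)^A`, sums over `N < 2ⁿ`): the evaluation of such a `P` at `0/1` points is a combination of the multilinear
monomials `x_S`, `|S| ≤ deg` (`mobius_eval_mem_lowDeg`), and `N ↦ bits` is a bijection `[0,2ⁿ) ≃ {0,1}ⁿ`;
(2) the kernel-checked Razborov–Smolensky glue `LiouvilleNotAC0Xor_proof : DigitPolyUniformity → bin {N : λ(N) = -1} ∉ AC⁰[2]`;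
(3) sign transfer inside `AC⁰[2]` (negation + conjunction with the top bit, `ACRealOver` over `accBasis 2`).
-/

set_option linter.dupNamespace false -- `Summit.PneNP.PneNP.…`: summit = sub-problem name (D-0017 single-conjunct layout)

namespace Summit.PneNP.PneNP.Theorems

open _root_.Computability Polynomial Finset
open Literature.Computability.Complexity Literature.Computability.MetaComplexity
open Summit.QuantumAdvantage.QuantumAdvantage.Theorems.MobiusLadder
  (ofFn_testBit_mem_toLanguage_iff testBit_eq_true_of_two_pow_le liouville_eq_one_or_eq_neg_one
    bitsToNat_ofFn_testBit LiouvilleNotAC0Xor_proof)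

/-- **From polynomials to the degree filtration**: the `0/1`-evaluation of `P : 𝔽₂[x₁,…,xₙ]` of total degree `≤ D` lies in
Smolensky's `lowDeg (ZMod 2) n D` (each monomial `x^v` evaluates to the multilinear `x_{supp v}`, `|supp v| ≤ deg v ≤ D`).
[cite: Smolensky1987, p. 78 (the algebra U_F^n)] [folklore] -/
theorem mobius_eval_mem_lowDeg {n D : ℕ} (P : MvPolynomial (Fin n) (ZMod 2)) (hP : P.totalDegree ≤ D) :
    (fun x : Fin n → Bool => MvPolynomial.eval (fun i => if x i then (1 : ZMod 2) else 0) P) ∈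
      Smolensky.lowDeg (ZMod 2) n D := by
  have e : (fun x : Fin n → Bool => MvPolynomial.eval (fun i => if x i then (1 : ZMod 2) else 0) P) =
      ∑ v ∈ P.support, P.coeff v • Smolensky.mono (ZMod 2) v.support := by
    funext x
    rw [Finset.sum_apply]
    conv_lhs => rw [P.as_sum]
    rw [map_sum]
    refine Finset.sum_congr rfl fun v _ => ?_
    rw [MvPolynomial.eval_monomial, Pi.smul_apply, smul_eq_mul]
    congr 1
    rw [Finsupp.prod, Smolensky.mono]
    refine Finset.prod_congr rfl fun i hi => ?_
    have hvi : v i ≠ 0 := Finsupp.mem_support_iff.1 hi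
    cases x i
    · simp [zero_pow hvi]
    · simp
  rw [e]
  refine Submodule.sum_mem _ fun v hv => Submodule.smul_mem _ _ (Smolensky.mono_mem_lowDeg ?_)
  calc v.support.card = ∑ i ∈ v.support, 1 := by simp
    _ ≤ ∑ i ∈ v.support, v i := Finset.sum_le_sum fun i hi => Nat.one_le_iff_ne_zero.2 (Finsupp.mem_support_iff.1 hi)
    _ = v.sum fun _ e => e := rfl
    _ ≤ P.totalDegree := MvPolynomial.le_totalDegree hv
    _ ≤ D := hP

/-- **Step (1)**: the route's crux `LiouvilleDigitalPhases` implies QuantumAdvantage's `DigitPolyUniformity` (cube functions of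
low Smolensky degree ⊇ evaluations of low total-degree polynomials; reindex `N < 2ⁿ ↔ bits`). [cite: Green2012, p. 3] [folklore] -/
theorem mobius_digitPolyUniformity_of_digitalPhases (h : Summit.PneNP.PneNP.Theses.Mobius.LiouvilleDigitalPhases) :
    ∀ A : ℕ, ∀ ε : ℝ, 0 < ε → ∀ᶠ n : ℕ in Filter.atTop, ∀ P : MvPolynomial (Fin n) (ZMod 2),
      P.totalDegree ≤ Nat.log 2 n ^ A →
        |∑ N ∈ Finset.range (2 ^ n), ((ArithmeticFunction.liouville N : ℤ) : ℝ) *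
            (if MvPolynomial.eval (fun i : Fin n => if Nat.testBit N i then (1 : ZMod 2) else 0) P = 1
              then (-1 : ℝ) else 1)| ≤ ε * (2 : ℝ) ^ n := by
  -- (this is `Summit.QuantumAdvantage.QuantumAdvantage.Theses.MobiusLadder.DigitPolyUniformity`, spelled out)
  intro A ε hε
  obtain ⟨M, hM⟩ := h A ε hε
  filter_upwards [Filter.eventually_ge_atTop M] with n hn P hP
  have hf := hM n hn _ (mobius_eval_mem_lowDeg P hP)
  have hsum : ∑ N ∈ Finset.range (2 ^ n), ((ArithmeticFunction.liouville N : ℤ) : ℝ) *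
        (if MvPolynomial.eval (fun i : Fin n => if Nat.testBit N i then (1 : ZMod 2) else 0) P = 1
          then (-1 : ℝ) else 1) =
      ∑ x : Fin n → Bool, (ArithmeticFunction.liouville (bitsToNat (List.ofFn x)) : ℝ) *
        (if (fun x : Fin n → Bool => MvPolynomial.eval (fun i => if x i then (1 : ZMod 2) else 0) P) x = 0
          then (1 : ℝ) else -1) := by
    refine Finset.sum_nbij' (fun N => fun i : Fin n => Nat.testBit N i) (fun x => bitsToNat (List.ofFn x))
      (fun N _ => Finset.mem_univ _) (fun x _ => ?_) (fun N hN => ?_) (fun x _ => ?_) (fun N hN => ?_)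
    · rw [Finset.mem_range]
      have := bitsToNat_lt (List.ofFn x)
      rwa [List.length_ofFn] at this
    · rw [Finset.mem_range] at hN
      rw [bitsToNat_ofFn_testBit, Nat.mod_eq_of_lt hN]
    · funext i
      rw [testBit_bitsToNat_eq_getD, List.getD_eq_getElem?_getD, List.getElem?_ofFn]
      simp [i.isLt]
    · rw [Finset.mem_range] at hN
      rw [bitsToNat_ofFn_testBit, Nat.mod_eq_of_lt hN]
      congr 1
      beta_reduce
      generalize MvPolynomial.eval (fun i : Fin n => if Nat.testBit N i then (1 : ZMod 2) else 0) P = e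
      by_cases he : e = 0
      · rw [if_pos he, if_neg (by rw [he]; decide)]
      · have he1 : e = 1 := by revert he; revert e; decide
        rw [if_pos he1, if_neg he]
  rw [hsum]
  exact hf

/-- The sign flip `{λ = 1} ↦ {λ = -1}` at each length: on codewords of length `k+1` (top bit `1`, `N ≥ 2^k ≥ 1`) the two
indicators are complementary. [cite: AroraBarak2009, §1.2] [folklore] -/
theorem mobius_liouvilleNeg_indicator (k : ℕ) (u : Fin (k + 1) → Bool) :
    (encodingNatBool.toLanguage {N : ℕ | ArithmeticFunction.liouville N = -1} : Language Bool).boolIndicator (List.ofFn u) =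
      (!((encodingNatBool.toLanguage {N : ℕ | ArithmeticFunction.liouville N = 1} : Language Bool).boolIndicator
          (List.ofFn u)) && u (Fin.last k)) := by
  set L₁ : Language Bool := encodingNatBool.toLanguage {N : ℕ | ArithmeticFunction.liouville N = 1} with hL₁
  set L₂ : Language Bool := encodingNatBool.toLanguage {N : ℕ | ArithmeticFunction.liouville N = -1} with hL₂
  set N := bitsToNat (List.ofFn u) with hN
  have hNlt : N < 2 ^ (k + 1) := by
    have := bitsToNat_lt (List.ofFn u)
    rwa [List.length_ofFn] at this
  have hu : u = fun i : Fin (k + 1) => N.testBit i := by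
    funext i
    rw [hN, testBit_bitsToNat_eq_getD, List.getD_eq_getElem?_getD, List.getElem?_ofFn]
    simp [i.isLt]
  have h1 : List.ofFn u ∈ L₁ ↔ 2 ^ k ≤ N ∧ ArithmeticFunction.liouville N = 1 := by
    rw [hu]; exact ofFn_testBit_mem_toLanguage_iff _ hNlt
  have h2 : List.ofFn u ∈ L₂ ↔ 2 ^ k ≤ N ∧ ArithmeticFunction.liouville N = -1 := by
    rw [hu]; exact ofFn_testBit_mem_toLanguage_iff _ hNlt
  have htop : u (Fin.last k) = true ↔ 2 ^ k ≤ N := by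
    rw [hu]
    exact ⟨fun h => Nat.ge_two_pow_of_testBit h, fun h => testBit_eq_true_of_two_pow_le h hNlt⟩
  rw [Bool.eq_iff_iff, Bool.and_eq_true, Bool.not_eq_true', ← Bool.not_eq_true, htop]
  rw [show (L₂.boolIndicator (List.ofFn u) = true) = (List.ofFn u ∈ L₂) from
      propext (Set.mem_iff_boolIndicator _ _).symm,
    show (L₁.boolIndicator (List.ofFn u) = true) = (List.ofFn u ∈ L₁) from
      propext (Set.mem_iff_boolIndicator _ _).symm, h1, h2]
  constructor
  · rintro ⟨hk, hl⟩
    exact ⟨fun ⟨_, hl'⟩ => by rw [hl'] at hl; norm_num at hl, hk⟩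
  · rintro ⟨hnot, hk⟩
    refine ⟨hk, ?_⟩
    have hN0 : N ≠ 0 := by
      have : 0 < 2 ^ k := Nat.two_pow_pos k
      omega
    rcases liouville_eq_one_or_eq_neg_one hN0 with hl | hl
    · exact absurd ⟨hk, hl⟩ hnot
    · exact hl

/-- **Step (3), sign transfer in any constant-depth class over a basis `B ⊇ acBasis`**: a family of depth `d` and size
`p(n)` for `bin {λ = 1}` yields one of depth `d+1` and size `p(n)+2` for `bin {λ = -1}`. [cite: Vollmer1999, §1.2] [folklore] -/
theorem mobius_liouvilleNeg_mem_depthSizeClass_of_pos {B : Set GateFn} (hB : acBasis ⊆ B) {d : ℕ} {p : Polynomial ℕ}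
    (h : (encodingNatBool.toLanguage {N : ℕ | ArithmeticFunction.liouville N = 1} : Language Bool) ∈
      DepthSizeClass B (fun _ => d) (fun n => p.eval n)) :
    (encodingNatBool.toLanguage {N : ℕ | ArithmeticFunction.liouville N = -1} : Language Bool) ∈
      DepthSizeClass B (fun _ => d + 1) (fun n => (p + Polynomial.C 2).eval n) := by
  obtain ⟨C, hC, hdec⟩ := h
  have hnot : GateFn.not ∈ B := hB mem_acBasis_not
  set L₂ : Language Bool := encodingNatBool.toLanguage {N : ℕ | ArithmeticFunction.liouville N = -1} with hL₂
  have main : ∀ n : ℕ, ∃ D : Circuit (Fin n), D.IsOver B ∧ D.acDepth ≤ d + 1 ∧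
      D.size ≤ (p + Polynomial.C 2).eval n ∧ ∀ u : Fin n → Bool, D.eval u = L₂.boolIndicator (List.ofFn u) := by
    intro n
    cases n with
    | zero =>
      obtain ⟨D, hDB, hDd, hDs, hDe⟩ := (acRealOver_const (ι := Fin 0) hB false).toCircuit
      refine ⟨D, hDB, hDd.trans (by omega), hDs.trans (by simp), fun u => ?_⟩
      rw [hDe u]
      symm
      rw [← Bool.not_eq_true, show (L₂.boolIndicator (List.ofFn u) = true) = (List.ofFn u ∈ L₂) from
        propext (Set.mem_iff_boolIndicator _ _).symm]
      rintro ⟨M, hM, hMu⟩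
      have hM0 : M = 0 := by
        have h0 : bitsToNat (encodeNat M) = bitsToNat ([] : List Bool) := by
          rw [show (encodeNat M : List Bool) = List.ofFn u from hMu, List.ofFn_zero]
        simpa using h0
      subst hM0
      simp at hM
    | succ k =>
      have h0 : ACRealOver B (fun u : Fin (k + 1) → Bool => !(C (k + 1)).eval u) d (p.eval (k + 1) + 1) :=
        (ACRealOver.of_circuit (C (k + 1)) (hC (k + 1)).1 (hC (k + 1)).2.1 (hC (k + 1)).2.2).neg hnot
      have h1 : ACRealOver B (fun u : Fin (k + 1) → Bool => u (Fin.last k)) d 0 :=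
        (acRealOver_input B (Fin.last k)).mono (Nat.zero_le _) le_rfl
      have hall := acRealOver_forall hB (M := 2) (f := ![fun u => !(C (k + 1)).eval u, fun u => u (Fin.last k)])
        (d := d) (s := ![p.eval (k + 1) + 1, 0]) (fun j => by fin_cases j <;> simpa)
      obtain ⟨D, hDB, hDd, hDs, hDe⟩ := hall.toCircuit
      refine ⟨D, hDB, hDd, hDs.trans (by simp [Fin.sum_univ_two]), fun u => ?_⟩
      rw [hDe u, mobius_liouvilleNeg_indicator k u]
      simp [Fin.forall_fin_two, hdec.eval_eq u]
  choose D hD using main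
  refine ⟨D, fun n => ⟨(hD n).1, (hD n).2.1, (hD n).2.2.1⟩, fun x => ?_⟩
  have := (hD x.length).2.2.2 x.get
  rwa [List.ofFn_get] at this

/-- **Glue `DigitalPhasesGlue` of route Mobius (stmt-PneNP-1114)**: `LiouvilleDigitalPhases → bin {N : λ(N) = 1} ∉ AC⁰[2]`, by
step (1), the kernel-checked Razborov–Smolensky glue `LiouvilleNotAC0Xor_proof` of QuantumAdvantage/MobiusLadder for
`{λ = -1}`, and the sign transfer (3). [cite: Smolensky1987, Lemmas 1–2] [cite: Green2012, p. 3] -/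
theorem mobius_digitalPhasesGlue_proof : Summit.PneNP.PneNP.Theses.Mobius.DigitalPhasesGlue := by
  intro hX hL
  obtain ⟨d, p, hmem⟩ := hL
  exact LiouvilleNotAC0Xor_proof (mobius_digitPolyUniformity_of_digitalPhases hX)
    ⟨d + 1, p + Polynomial.C 2, mobius_liouvilleNeg_mem_depthSizeClass_of_pos (acBasis_subset_accBasis 2) hmem⟩

end Summit.PneNP.PneNP.Theorems
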